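import Literature.MathematicalPhysics.QuantumLattice.InfVolFermionState
import Literature.MathematicalPhysics.QuantumLattice.TwoClusterFock
import HarnessLib

/-!
# Torus limits of PARITY-DEFINITE families of torus vectors are even states

Topic `Literature/MathematicalPhysics/QuantumLattice`; namespace
`Literature.MathematicalPhysics.QuantumLattice` (the file path). Companion of `InfVolFermionState.lean`
§TorusLimits: the tree's `IsTorusLimitOf.isEven` asks for FIXED-PARTICLE-NUMBER vectors
(`IsNParticle (N L) (ψ L)`). The pair-sourced Hamiltonians `H − μN − h(Δ + Δ†)` break `U(1)` down to fermion
parity, and the trial states of the pinning-field programme (tiled products of parity-definite cluster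
vectors, `ClusterProductStates.hasParity_prodFamily`) are parity- but not number-definite. Here the same
conclusion is proved under the weaker hypothesis `TwoCluster.HasParity p ψ` (support on configurations of
cardinality `≡ p (mod 2)`, `TwoClusterFock.lean`): the expectation of `Θ A = P A P` in a parity-definite
vector equals that of `A` (`P ψ = ± ψ`), translations preserve parity, hence every averaged torus state of a
parity-definite vector is `Θ`-invariant and so is every weak-⋆ limit.

* `parityOp_mulVec_of_hasParity` (the tree's `parityOp` of `FermionOperators.lean`, which `parityAut` uses),
  `expect_parityAut_of_hasParity`, `TwoCluster.HasParity.fockRelabel_mulVec`.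
* `torusAvgExpectAt_parityAut_of_hasParity`, `torusAvgExpect_parityAut_of_hasParity`.
* `InfVolFermionState.IsTorusLimitOf.isEven_of_hasParity` — torus limits of families that are
  parity-definite ALONG THE SIDE SEQUENCE are even states (Araki–Moriya 2003 §4.1 Def. 4.5).

Everything is PROVED; no definition, no named fact, zero compute.

## References
* H. Araki, H. Moriya, Rev. Math. Phys. 15 (2003) 93, §4.1 Def. 4.5 (even = `Θ`-invariant states).
  [cite: ArakiMoriya2003, §4.1 Def. 4.5]
* O. Bratteli, D. W. Robinson, *Operator Algebras and Quantum Statistical Mechanics 1* (1987), §4.3.1.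
  [cite: BratteliRobinsonI1987, §4.3.1]
-/

noncomputable section

namespace Literature.MathematicalPhysics.QuantumLattice

open Matrix Finset HubbardWave0 _root_.Filter Literature.Probability.LatticeModels
open scoped _root_.Topology ComplexOrder

/-! ### Parity-definite vectors and the even–odd automorphism -/

section Parity

variable {ι : Type*} [LinearOrder ι] [Fintype ι]

/-- On a vector of fermion parity `p` the parity operator `P = (-1)^N` (`FermionOperators.parityOp`, the one
`parityAut` is built from) acts as the scalar `(-1)^p`. [folklore] -/
private theorem parityOp_mulVec_of_hasParity {p : ℕ} {ψ : Fock ι} (hψ : TwoCluster.HasParity p ψ) :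
    parityOp *ᵥ ψ = ((-1 : ℂ) ^ p) • ψ := by
  ext s
  rw [parityOp, Matrix.mulVec_diagonal, Pi.smul_apply, smul_eq_mul]
  by_cases hs : ψ s = 0
  · rw [hs, mul_zero, mul_zero]
  · rw [neg_one_pow_eq_pow_mod_two, hψ s hs, ← neg_one_pow_eq_pow_mod_two]

/-- **In a parity-definite vector the expectations of `Θ B = P B P` and `B` agree** (`P ψ = ± ψ`).
[cite: ArakiMoriya2003, §4.1 Def. 4.5] -/
theorem expect_parityAut_of_hasParity {p : ℕ} {ψ : Fock ι} (hψ : TwoCluster.HasParity p ψ)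
    (B : Matrix (Finset ι) (Finset ι) ℂ) : expect (parityAut B) ψ = expect B ψ := by
  have hP : (parityOp : Matrix (Finset ι) (Finset ι) ℂ)ᴴ = parityOp := by
    rw [parityOp, Matrix.diagonal_conjTranspose]
    congr 1
    funext s
    simp
  rw [parityAut_apply, expect, expect, ← Matrix.mulVec_mulVec, ← Matrix.mulVec_mulVec,
    parityOp_mulVec_of_hasParity hψ, Matrix.mulVec_smul, Matrix.dotProduct_mulVec,
    ← Matrix.conjTranspose_conjTranspose parityOp, ← Matrix.star_mulVec, hP,
    parityOp_mulVec_of_hasParity hψ, star_smul, dotProduct_smul, smul_dotProduct, smul_smul]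
  have h1 : (-1 : ℂ) ^ p * star ((-1 : ℂ) ^ p) = 1 := by
    rw [star_pow, star_neg, star_one, ← mul_pow]
    norm_num
  rw [h1, one_smul]

/-- **Orbital relabellings preserve fermion parity** (the second quantisation `U_π` of a one-particle
permutation permutes the occupation basis preserving `|s|`; Bratteli–Robinson II §5.2.2).
[cite: BratteliRobinsonII1997, §5.2.2, Thm. 5.2.5] -/
theorem TwoCluster.HasParity.fockRelabel_mulVec {p : ℕ} {ψ : Fock ι} (hψ : TwoCluster.HasParity p ψ)
    (π : Equiv.Perm ι) : TwoCluster.HasParity p ((fockRelabel π).val *ᵥ ψ) := by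
  intro s' hs'
  rw [fockRelabel_mulVec_apply] at hs'
  have h := hψ _ (right_ne_zero_of_mul hs')
  rwa [Equiv.finsetCongr_symm, Equiv.finsetCongr_apply, Finset.card_map] at h

end Parity

/-! ### Averaged torus expectations and torus limits of parity-definite vectors -/

section Torus

variable {d : ℕ}

/-- **The averaged torus expectations of a parity-definite vector are even**: `Θ A` and `A` have the same
value (the translates `U_v ψ` are again parity-definite, and `Γ` commutes with `Θ`).
[cite: ArakiMoriya2003, §4.1 Def. 4.5] -/
theorem torusAvgExpectAt_parityAut_of_hasParity (L : ℕ) [NeZero L] (Λ : Finset (Site d)) (A : FermionOp Λ)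
    {p : ℕ} {ψ : Fock (Orb (FermionTorus d L))} (hψ : TwoCluster.HasParity p ψ) :
    torusAvgExpectAt L Λ (parityAut A) ψ = torusAvgExpectAt L Λ A ψ := by
  by_cases h : Set.InjOn (Torus.proj (d := d) L) ↑Λ
  · rw [torusAvgExpectAt_of_injOn L h, torusAvgExpectAt_of_injOn L h, fermionEmbed_parityAut]
    refine congrArg (fun z : ℂ => ((Fintype.card (TorusSite d L) : ℂ))⁻¹ * z) ?_
    refine Finset.sum_congr rfl fun v _ => ?_
    exact expect_parityAut_of_hasParity (hψ.fockRelabel_mulVec _) _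
  · rw [torusAvgExpectAt_of_not_injOn L h, torusAvgExpectAt_of_not_injOn L h]

/-- `torusAvgExpectAt_parityAut_of_hasParity` for arbitrary side. [cite: ArakiMoriya2003, §4.1 Def. 4.5] -/
theorem torusAvgExpect_parityAut_of_hasParity (L : ℕ) (Λ : Finset (Site d)) (A : FermionOp Λ) {p : ℕ}
    {ψ : Fock (Orb (FermionTorus d L))} (hψ : TwoCluster.HasParity p ψ) :
    torusAvgExpect L Λ (parityAut A) ψ = torusAvgExpect L Λ A ψ := by
  rcases Nat.eq_zero_or_pos L with rfl | hL
  · rw [torusAvgExpect_zero, torusAvgExpect_zero]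
  · haveI : NeZero L := NeZero.of_pos hL
    rw [torusAvgExpect_eq, torusAvgExpect_eq, torusAvgExpectAt_parityAut_of_hasParity L Λ A hψ]

/-- **Torus limits of parity-definite families are even states.** If `ω` is a torus limit of `ψ` along
`Ls` and each `ψ (Ls j)` has a definite fermion parity `p j` (e.g. tiled products of parity-definite cluster
vectors; no fixed particle number needed), then `ω` is even. [cite: ArakiMoriya2003, §4.1 Def. 4.5] -/
theorem InfVolFermionState.IsTorusLimitOf.isEven_of_hasParity {ω : InfVolFermionState d}
    {ψ : ∀ L, Fock (Orb (FermionTorus d L))} {Ls : ℕ → ℕ} (h : ω.IsTorusLimitOf ψ Ls) {p : ℕ → ℕ}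
    (hψ : ∀ j, TwoCluster.HasParity (p j) (ψ (Ls j))) : ω.IsEven := by
  intro Λ A
  refine tendsto_nhds_unique (h Λ (parityAut A)) ?_
  have hrw : (fun j => torusAvgExpect (Ls j) Λ (parityAut A) (ψ (Ls j))) =
      fun j => torusAvgExpect (Ls j) Λ A (ψ (Ls j)) :=
    funext fun j => torusAvgExpect_parityAut_of_hasParity _ Λ A (hψ j)
  rw [hrw]
  exact h Λ A

end Torus

end Literature.MathematicalPhysics.QuantumLattice

end
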